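import Summits.QuantumFields.BalabanUV.T4Continuum.Support.NE3BlockMeanExactInterpolant
import HarnessLib

/-!
# T⁴ programme, node NE3 — census R32 (exact half, step 2a, file 1): THE LINE AVERAGE ALONG ONE AXIS — an `ℓ²`-contraction on periodic
# data that commutes with the coboundary, TELESCOPES its own-axis difference into a coarse difference over `M`, and moves a periodic field
# by at most `M·‖∂_j u‖`

Cell `pub-balaban-gaps` (track G2, seat `ne3`; writer prover-pub-balaban-gaps-ne3-g6-0, 2026-08-23), census `run/shared/lean/pub/pub-balaban-gaps/ne/NE3.md`
§4 R32.  WHY.  `SlicB8LandauReduction` (p363714) reduced the flat slice Poincaré inequality (P♮) on B8's slice `slicB8` for `N ≥ 2` to ONE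
interpolation lemma: a competitor `ũ` with the nested block means of the Hodge potential and with BOTH `Σ‖dũ‖² ≲ M^{d−2}Σ|∇q|²` and
`Σ‖Δũ‖² ≲ M^{d−4}Σ|∇q|²` (`M = L^{j+1}`).  The tree's block-mean-exact interpolant `NE3BlockMeanExactInterpolant.bmeInterp` is only `C⁰`; the
route of this seat (gen 6) is to SMOOTH it by the composition of the `d` line averages and to restore exact block means with a squared-tent
bump.  THIS FILE is the one-axis kinematics: `lineAvg M i u x = M⁻¹ • Σ_{s<M} u (x + s•e_i)`; translation and periodicity
(`lineAvg_shift`, `lineAvg_add_period`), commutation with `dPot` (`dPot_lineAvg`), THE TELESCOPING GAIN **`dPot_lineAvg_self`**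
(`dPot (lineAvg M i u) x i = M⁻¹ • (u (x + M•e_i) − u x)`), pointwise Jensen and the `ℓ²(periodBox P)`-CONTRACTION **`sum_normSq_lineAvg_le`**,
one-dimensional paths `sum_normSq_sub_shift_le` (`Σ_x ‖u (x + s e_j) − u x‖² ≤ s²·Σ_x ‖dPot u x j‖²`) and the displacement
**`sum_normSq_sub_lineAvg_le`** (`Σ_x ‖u x − lineAvg M j u x‖² ≤ M²·Σ_x ‖dPot u x j‖²`).  File 2 (`NE3LineAverageSmoothing`) iterates over the axes.

CONTENT ([folklore] lattice calculus; 0 sorry; ONE DATA def `lineAvg`), `𝔸` a real normed ring-module, `M ≥ 1`, `P ≥ 1`.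

HONEST FRAMING.  Pure lattice calculus on the periodic lattice; nothing about Bałaban's minimisers; (P♮) on `slicB8`, T-E_w and **NE3 are NOT
proved** here; spine PROVED 0∕9; finite T⁴ rung (B)+1 — NOT continuum YM on ℝ⁴, NOT infinite volume, NOT mass gap, NOT Clay.
PLACEMENT: `Summits/QuantumFields/BalabanUV/T4Continuum/Support/`.
-/

set_option autoImplicit false

open scoped BigOperators
open Finset

namespace Summit.QuantumFields.BalabanUV.T4Continuum.NE3LineAverage

open Literature.MathematicalPhysics.QuantumFieldTheory.Balaban1983to89
open B7Prop1Explicit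
open T4AveragingDeficitWallBoundary (periodBox mem_periodBox card_periodBox sum_periodBox_shift)
open NE3TangentNoGoWords (dPot)
open NE3BlockMeanExactInterpolant (normSq_sum_le_card_mul)

noncomputable section

variable {d : ℕ}
variable {𝔸 : Type*} [NormedRing 𝔸] [NormedSpace ℝ 𝔸]

/-! ## §1 The line average along one axis -/

/-- THE FORWARD LINE AVERAGE along axis `i` over `M` steps: `lineAvg M i u x = M⁻¹ • Σ_{s<M} u (x + s•e_i)`. [folklore] -/
def lineAvg (M : ℕ) (i : Fin d) (u : Site d → 𝔸) (x : Site d) : 𝔸 :=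
  ((M : ℝ)⁻¹) • ∑ s ∈ Finset.range M, u (x + (s : ℤ) • e i)

/-- The line average commutes with translations. [folklore] -/
theorem lineAvg_shift (M : ℕ) (i : Fin d) (u : Site d → 𝔸) (v x : Site d) :
    lineAvg M i (fun y => u (y + v)) x = lineAvg M i u (x + v) := by
  unfold lineAvg
  congr 1
  exact Finset.sum_congr rfl fun s _ => by rw [add_right_comm]

/-- The line average of a difference. [folklore] -/
theorem lineAvg_sub (M : ℕ) (i : Fin d) (u w : Site d → 𝔸) (x : Site d) :
    lineAvg M i (fun y => u y - w y) x = lineAvg M i u x - lineAvg M i w x := by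
  unfold lineAvg
  rw [Finset.sum_sub_distrib, smul_sub]

/-- Periodicity is preserved by the line average. [folklore] -/
theorem lineAvg_add_period (M : ℕ) (i : Fin d) {P : ℕ} {u : Site d → 𝔸}
    (hu : ∀ (x : Site d) (τ : Fin d), u (x + (P : ℤ) • e τ) = u x) (x : Site d) (τ : Fin d) :
    lineAvg M i u (x + (P : ℤ) • e τ) = lineAvg M i u x := by
  unfold lineAvg
  congr 1
  exact Finset.sum_congr rfl fun s _ => by rw [add_right_comm, hu]

/-- **THE LINE AVERAGE COMMUTES WITH THE COBOUNDARY**: `dPot (lineAvg M i u) x α = lineAvg M i (dPot u · α) x`. [folklore] -/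
theorem dPot_lineAvg (M : ℕ) (i : Fin d) (u : Site d → 𝔸) (x : Site d) (α : Fin d) :
    dPot (lineAvg M i u) x α = lineAvg M i (fun y => dPot u y α) x := by
  simp only [dPot, lineAvg, ← smul_sub, ← Finset.sum_sub_distrib]
  congr 1
  exact Finset.sum_congr rfl fun s _ => by rw [add_right_comm]

/-- **THE TELESCOPING GAIN**: along its own axis the coboundary of the line average is a COARSE difference over `M`:
`dPot (lineAvg M i u) x i = M⁻¹ • (u (x + M•e_i) − u x)`. [folklore] -/
theorem dPot_lineAvg_self (M : ℕ) (i : Fin d) (u : Site d → 𝔸) (x : Site d) :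
    dPot (lineAvg M i u) x i = ((M : ℝ)⁻¹) • (u (x + ((M : ℕ) : ℤ) • e i) - u x) := by
  rw [dPot_lineAvg]
  unfold lineAvg
  congr 1
  have htel := Finset.sum_range_sub (fun s : ℕ => u (x + (s : ℤ) • e i)) M
  simp only [Nat.cast_zero, zero_smul, add_zero] at htel
  rw [← htel]
  refine Finset.sum_congr rfl fun s _ => ?_
  simp only [dPot]
  congr 2
  rw [add_assoc, ← add_one_zsmul]
  push_cast
  rfl

/-- Pointwise Jensen: `‖lineAvg M i g x‖² ≤ M⁻¹·Σ_{s<M} ‖g (x + s•e_i)‖²` (`M ≥ 1`). [folklore] -/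
theorem normSq_lineAvg_le {M : ℕ} (hM : 1 ≤ M) (i : Fin d) (g : Site d → 𝔸) (x : Site d) :
    ‖lineAvg M i g x‖ ^ 2 ≤ ((M : ℝ)⁻¹) * ∑ s ∈ Finset.range M, ‖g (x + (s : ℤ) • e i)‖ ^ 2 := by
  have hM0 : (0 : ℝ) < M := by exact_mod_cast (by omega : 0 < M)
  unfold lineAvg
  rw [norm_smul, mul_pow, Real.norm_of_nonneg (inv_nonneg.mpr hM0.le)]
  have h := normSq_sum_le_card_mul (Finset.range M) (fun s => g (x + (s : ℤ) • e i))
  rw [Finset.card_range] at h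
  calc ((M : ℝ)⁻¹) ^ 2 * ‖∑ s ∈ Finset.range M, g (x + (s : ℤ) • e i)‖ ^ 2
      ≤ ((M : ℝ)⁻¹) ^ 2 * ((M : ℝ) * ∑ s ∈ Finset.range M, ‖g (x + (s : ℤ) • e i)‖ ^ 2) :=
        mul_le_mul_of_nonneg_left h (by positivity)
    _ = ((M : ℝ)⁻¹) * ∑ s ∈ Finset.range M, ‖g (x + (s : ℤ) • e i)‖ ^ 2 := by
        field_simp

/-- **THE LINE AVERAGE IS AN `ℓ²`-CONTRACTION ON PERIODIC DATA**: for `P ≥ 1`, `M ≥ 1` and `P`-periodic `g`,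
`Σ_{x∈periodBox P} ‖lineAvg M i g x‖² ≤ Σ_{x∈periodBox P} ‖g x‖²`. [folklore] -/
theorem sum_normSq_lineAvg_le {M : ℕ} (hM : 1 ≤ M) {P : ℕ} (hP : 1 ≤ P) (i : Fin d) {g : Site d → 𝔸}
    (hg : ∀ (x : Site d) (τ : Fin d), g (x + (P : ℤ) • e τ) = g x) :
    ∑ x ∈ periodBox (d := d) P, ‖lineAvg M i g x‖ ^ 2 ≤ ∑ x ∈ periodBox (d := d) P, ‖g x‖ ^ 2 := by
  have hM0 : (0 : ℝ) < M := by exact_mod_cast (by omega : 0 < M)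
  have hshift : ∀ s : ℕ, ∑ x ∈ periodBox (d := d) P, ‖g (x + (s : ℤ) • e i)‖ ^ 2 = ∑ x ∈ periodBox (d := d) P, ‖g x‖ ^ 2 :=
    fun s => sum_periodBox_shift P hP (g := fun x => ‖g x‖ ^ 2) (fun x κ => by simp only [hg]) ((s : ℤ) • e i)
  calc ∑ x ∈ periodBox (d := d) P, ‖lineAvg M i g x‖ ^ 2
      ≤ ∑ x ∈ periodBox (d := d) P, ((M : ℝ)⁻¹) * ∑ s ∈ Finset.range M, ‖g (x + (s : ℤ) • e i)‖ ^ 2 :=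
        Finset.sum_le_sum fun x _ => normSq_lineAvg_le hM i g x
    _ = ((M : ℝ)⁻¹) * ∑ s ∈ Finset.range M, ∑ x ∈ periodBox (d := d) P, ‖g (x + (s : ℤ) • e i)‖ ^ 2 := by
        rw [← Finset.mul_sum, Finset.sum_comm]
    _ = ((M : ℝ)⁻¹) * ∑ _s ∈ Finset.range M, ∑ x ∈ periodBox (d := d) P, ‖g x‖ ^ 2 := by
        congr 1
        exact Finset.sum_congr rfl fun s _ => hshift s
    _ = ∑ x ∈ periodBox (d := d) P, ‖g x‖ ^ 2 := by
        rw [Finset.sum_const, Finset.card_range, nsmul_eq_mul]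
        field_simp

omit [NormedSpace ℝ 𝔸] in
/-- A coboundary of a periodic field is periodic. [folklore] -/
theorem dPot_add_period {P : ℕ} {u : Site d → 𝔸} (hu : ∀ (x : Site d) (τ : Fin d), u (x + (P : ℤ) • e τ) = u x)
    (α : Fin d) (x : Site d) (τ : Fin d) : dPot u (x + (P : ℤ) • e τ) α = dPot u x α := by
  simp only [dPot]
  rw [add_right_comm, hu, hu]

omit [NormedSpace ℝ 𝔸] in
/-- **ONE-DIMENSIONAL PATHS**: `Σ_{x∈periodBox P} ‖u (x + s•e_j) − u x‖² ≤ s²·Σ_x ‖dPot u x j‖²` for `P`-periodic `u` (telescoping along the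
axis, Cauchy–Schwarz, shift-invariance of periodic sums). [folklore] -/
theorem sum_normSq_sub_shift_le {P : ℕ} (hP : 1 ≤ P) {u : Site d → 𝔸}
    (hu : ∀ (x : Site d) (τ : Fin d), u (x + (P : ℤ) • e τ) = u x) (j : Fin d) (s : ℕ) :
    ∑ x ∈ periodBox (d := d) P, ‖u (x + (s : ℤ) • e j) - u x‖ ^ 2
      ≤ (s : ℝ) ^ 2 * ∑ x ∈ periodBox (d := d) P, ‖dPot u x j‖ ^ 2 := by
  -- telescoping: `u (x + s e) − u x = Σ_{t<s} dPot u (x + t e) j`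
  have htel : ∀ x : Site d, u (x + (s : ℤ) • e j) - u x = ∑ t ∈ Finset.range s, dPot u (x + (t : ℤ) • e j) j := by
    intro x
    have h := Finset.sum_range_sub (fun t : ℕ => u (x + (t : ℤ) • e j)) s
    simp only [Nat.cast_zero, zero_smul, add_zero] at h
    rw [← h]
    refine Finset.sum_congr rfl fun t _ => ?_
    simp only [dPot]
    congr 2
    rw [add_assoc, ← add_one_zsmul]
    push_cast
    rfl
  have hshift : ∀ t : ℕ, ∑ x ∈ periodBox (d := d) P, ‖dPot u (x + (t : ℤ) • e j) j‖ ^ 2 = ∑ x ∈ periodBox (d := d) P, ‖dPot u x j‖ ^ 2 :=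
    fun t => sum_periodBox_shift P hP (g := fun x => ‖dPot u x j‖ ^ 2) (fun x κ => by simp only [dPot_add_period hu]) ((t : ℤ) • e j)
  calc ∑ x ∈ periodBox (d := d) P, ‖u (x + (s : ℤ) • e j) - u x‖ ^ 2
      = ∑ x ∈ periodBox (d := d) P, ‖∑ t ∈ Finset.range s, dPot u (x + (t : ℤ) • e j) j‖ ^ 2 :=
        Finset.sum_congr rfl fun x _ => by rw [htel x]
    _ ≤ ∑ x ∈ periodBox (d := d) P, ((s : ℝ) * ∑ t ∈ Finset.range s, ‖dPot u (x + (t : ℤ) • e j) j‖ ^ 2) :=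
        Finset.sum_le_sum fun x _ => by
          have h := normSq_sum_le_card_mul (Finset.range s) (fun t => dPot u (x + (t : ℤ) • e j) j)
          rwa [Finset.card_range] at h
    _ = (s : ℝ) * ∑ t ∈ Finset.range s, ∑ x ∈ periodBox (d := d) P, ‖dPot u (x + (t : ℤ) • e j) j‖ ^ 2 := by
        rw [← Finset.mul_sum, Finset.sum_comm]
    _ = (s : ℝ) * ∑ _t ∈ Finset.range s, ∑ x ∈ periodBox (d := d) P, ‖dPot u x j‖ ^ 2 := by
        congr 1; exact Finset.sum_congr rfl fun t _ => hshift t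
    _ = (s : ℝ) ^ 2 * ∑ x ∈ periodBox (d := d) P, ‖dPot u x j‖ ^ 2 := by
        rw [Finset.sum_const, Finset.card_range, nsmul_eq_mul]; ring

/-- **THE LINE AVERAGE MOVES A PERIODIC FIELD BY AT MOST `M·‖∂_j u‖`**: `Σ_x ‖u x − lineAvg M j u x‖² ≤ M²·Σ_x ‖dPot u x j‖²`. [folklore] -/
theorem sum_normSq_sub_lineAvg_le {M : ℕ} (hM : 1 ≤ M) {P : ℕ} (hP : 1 ≤ P) (j : Fin d) {u : Site d → 𝔸}
    (hu : ∀ (x : Site d) (τ : Fin d), u (x + (P : ℤ) • e τ) = u x) :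
    ∑ x ∈ periodBox (d := d) P, ‖u x - lineAvg M j u x‖ ^ 2
      ≤ (M : ℝ) ^ 2 * ∑ x ∈ periodBox (d := d) P, ‖dPot u x j‖ ^ 2 := by
  have hM0 : (0 : ℝ) < M := by exact_mod_cast (by omega : 0 < M)
  set G : ℝ := ∑ x ∈ periodBox (d := d) P, ‖dPot u x j‖ ^ 2 with hG
  have hG0 : 0 ≤ G := Finset.sum_nonneg fun _ _ => sq_nonneg _
  -- `u x − lineAvg u x = lineAvg (u x − u (x + s e))`
  have hrepr : ∀ x : Site d, u x - lineAvg M j u x = ((M : ℝ)⁻¹) • ∑ s ∈ Finset.range M, (u x - u (x + (s : ℤ) • e j)) := by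
    intro x
    unfold lineAvg
    rw [Finset.sum_sub_distrib, Finset.sum_const, Finset.card_range, smul_sub, ← Nat.cast_smul_eq_nsmul ℝ, smul_smul,
      inv_mul_cancel₀ hM0.ne', one_smul]
  have hpt : ∀ x : Site d, ‖u x - lineAvg M j u x‖ ^ 2 ≤ ((M : ℝ)⁻¹) * ∑ s ∈ Finset.range M, ‖u (x + (s : ℤ) • e j) - u x‖ ^ 2 := by
    intro x
    rw [hrepr x, norm_smul, mul_pow, Real.norm_of_nonneg (inv_nonneg.mpr hM0.le)]
    have h := normSq_sum_le_card_mul (Finset.range M) (fun s => u x - u (x + (s : ℤ) • e j))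
    rw [Finset.card_range] at h
    calc ((M : ℝ)⁻¹) ^ 2 * ‖∑ s ∈ Finset.range M, (u x - u (x + (s : ℤ) • e j))‖ ^ 2
        ≤ ((M : ℝ)⁻¹) ^ 2 * ((M : ℝ) * ∑ s ∈ Finset.range M, ‖u x - u (x + (s : ℤ) • e j)‖ ^ 2) :=
          mul_le_mul_of_nonneg_left h (by positivity)
      _ = ((M : ℝ)⁻¹) * ∑ s ∈ Finset.range M, ‖u (x + (s : ℤ) • e j) - u x‖ ^ 2 := by
          have hsw : ∑ s ∈ Finset.range M, ‖u x - u (x + (s : ℤ) • e j)‖ ^ 2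
              = ∑ s ∈ Finset.range M, ‖u (x + (s : ℤ) • e j) - u x‖ ^ 2 :=
            Finset.sum_congr rfl fun s _ => by rw [norm_sub_rev]
          rw [hsw]
          field_simp
  calc ∑ x ∈ periodBox (d := d) P, ‖u x - lineAvg M j u x‖ ^ 2
      ≤ ∑ x ∈ periodBox (d := d) P, ((M : ℝ)⁻¹) * ∑ s ∈ Finset.range M, ‖u (x + (s : ℤ) • e j) - u x‖ ^ 2 :=
        Finset.sum_le_sum fun x _ => hpt x
    _ = ((M : ℝ)⁻¹) * ∑ s ∈ Finset.range M, ∑ x ∈ periodBox (d := d) P, ‖u (x + (s : ℤ) • e j) - u x‖ ^ 2 := by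
        rw [← Finset.mul_sum, Finset.sum_comm]
    _ ≤ ((M : ℝ)⁻¹) * ∑ s ∈ Finset.range M, ((M : ℝ) ^ 2 * G) := by
        refine mul_le_mul_of_nonneg_left (Finset.sum_le_sum fun s hs => ?_) (by positivity)
        have hsM : (s : ℝ) ≤ M := by exact_mod_cast (Finset.mem_range.mp hs).le
        calc ∑ x ∈ periodBox (d := d) P, ‖u (x + (s : ℤ) • e j) - u x‖ ^ 2 ≤ (s : ℝ) ^ 2 * G := sum_normSq_sub_shift_le hP hu j s
          _ ≤ (M : ℝ) ^ 2 * G := mul_le_mul_of_nonneg_right (pow_le_pow_left₀ (Nat.cast_nonneg _) hsM 2) hG0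
    _ = (M : ℝ) ^ 2 * G := by
        rw [Finset.sum_const, Finset.card_range, nsmul_eq_mul]
        field_simp

end

end Summit.QuantumFields.BalabanUV.T4Continuum.NE3LineAverage
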